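import Literature.AnabelianGeometry.SemiGraphs.TemperedPiChartExists
import HarnessLib

/-!
# Galois level data from a PRESCRIBED tower of Galois finite étale coverings ([SemiAnbd] Prop 3.6 p. 38)

Mochizuki, *Semi-graphs of anabelioids*, Publ. RIMS **42** (2006), §3 p. 38: "Let `{G_i → G}_{i ∈ I}` be
some cofinal collection of connected finite étale Galois coverings … `π₁^temp(G) := lim Gal(G_{∞,i}/G)`.
Note that `π₁^temp(G)` is independent, up to inner automorphism, of the choice of the cofinal system"
[cite: MochizukiSemiAnbd2006, Prop 3.6 p.38]; §5 Prop 5.2 (i)/(iv) p. 64 (the arithmetic situation,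
where the levels must be chosen stable under the arithmetic action).

Seat abc-iut-L3-t9 (the Galois-tower lineage), cell row T54-B (`plan/GAP-LEDGER.md` G-w4d053-1) sub-row
(E1a) "a `GaloisLevelData` constructor from a PRESCRIBED cofinal antitone family … (abc-iut-L3-t9's
`galoisLevelData h36` is a fixed enumeration, not E-stable)".  The constructor `galoisLevelData h36` of
`TemperedPiExistence.lean` makes ARBITRARY choices (the Galois tower over the Galois-countability family);
here the SAME construction is performed over ANY prescribed sequence of connected Galois objects `A n` of
the Galois category `B(𝒢)` with transition morphisms `A (n+1) ⟶ A n`: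

* `GaloisLevelData.ofGaloisSeq hc v₀ A hA f` — levels `S n := ofBObj (A n)`, transitions `ofBObj (f n)`,
  point-transitivity from the Galois property (`htrans_of_isGalois`), compatible base points over `v₀`
  chosen along the (fibre-surjective) transition maps;
* its levels split themselves, are finite, have nonempty fibres (`ofGaloisSeq_splits_self`,
  `ofGaloisSeq_isFinite`, `ofGaloisSeq_hasNonemptyFibres`) — the inputs of the tempered-group / chart
  machinery (`isTempered_temperedPi`, `fibreObj`, `realize`, …), so `(ofGaloisSeq …).temperedPi` is a
  tempered group by `isTempered_temperedPi` verbatim;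
* COFINALITY TRANSFER `ofGaloisSeq_exists_level_splits_component(_of_dominates)`: if the prescribed tower
  dominates abc-iut-L3-t9's tower `galoisLevelData h36` (or the Galois-countability family) level by
  level, then every component of every tempered covering is split by the prescribed levels from some
  level on — the cofinality clause on which `TemperedPiLevels/Functor/ChartExists` run.

So a producer of E-stable (characteristic, or `F`-stable) Galois OBJECTS obtains E-stable Galois LEVEL
DATA with the full tempered-group package.  Nothing is asserted about the existence of such objects
(sub-rows (E1b)/(E1c) of the GAP row); no side is taken on [IUTchIII] Cor 3.12; typed ≠ proved.
-/

namespace Literature.AnabelianGeometry.SemiGraphs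

namespace ProfiniteSemiGraph

open CategoryTheory CategoryTheory.PreGaloisCategory Literature.AnabelianGeometry.Anabelioids
open scoped FintypeCatDiscrete

universe u

variable (𝒢 : ProfiniteSemiGraph.{u}) (hc : 𝒢.graph.IsConnected) (v₀ : 𝒢.graph.Vertex)
  (A : ℕ → 𝒢.toAnab.BObj)
  (hA : ∀ n, letI := SemiGraphOfAnabelioids.galoisCategory_bObj 𝒢.toAnab ⟨hc⟩; IsGalois (A n))
  (f : ∀ n, A (n + 1) ⟶ A n)

/-- A morphism of `B(𝒢)` INTO a connected Galois object from an object with nonempty fibres is onto on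
every fibre (epimorphisms of a Galois category). [cite: MochizukiSemiAnbd2006, Prop 3.6 p.38] -/
theorem ofBObj_map_fV_surjective_of_isGalois {X Y : 𝒢.toAnab.BObj}
    (hX : letI := SemiGraphOfAnabelioids.galoisCategory_bObj 𝒢.toAnab ⟨hc⟩; IsGalois X)
    (hY : letI := SemiGraphOfAnabelioids.galoisCategory_bObj 𝒢.toAnab ⟨hc⟩; IsGalois Y)
    (φ : X ⟶ Y) (v : 𝒢.graph.Vertex) :
    Function.Surjective ((𝒢.ofBObj.map φ).fV v).hom.hom := by
  letI := SemiGraphOfAnabelioids.galoisCategory_bObj 𝒢.toAnab ⟨hc⟩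
  haveI := 𝒢.fiberFunctor_fiberAt hc v
  haveI := hX
  haveI := hY
  haveI : Epi φ := epi_of_nonempty_of_isConnected (𝒢.fiberAt v) _
  exact surjective_on_fiber_of_epi (𝒢.fiberAt v) φ

include hA in
/-- The fibres of the prescribed Galois objects are nonempty. [cite: MochizukiSemiAnbd2006, Prop 3.6 p.38] -/
theorem nonempty_fiberAt_seq (v : 𝒢.graph.Vertex) (n : ℕ) :
    Nonempty ((𝒢.ofBObj.obj (A n)).SV v).obj.V := by
  letI := SemiGraphOfAnabelioids.galoisCategory_bObj 𝒢.toAnab ⟨hc⟩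
  haveI := 𝒢.fiberFunctor_fiberAt hc v
  haveI := hA n
  exact nonempty_fiber_of_isConnected (𝒢.fiberAt v) (A n)

/-- Compatible base points over `v₀` along the prescribed tower (chosen recursively along the
fibre-surjective transition maps). [cite: MochizukiSemiAnbd2006, Prop 3.6 p.38] -/
noncomputable def seqBasePoint : ∀ n : ℕ, ((𝒢.ofBObj.obj (A n)).SV v₀).obj.V
  | 0 => Classical.choice (𝒢.nonempty_fiberAt_seq hc A hA v₀ 0)
  | n + 1 => (𝒢.ofBObj_map_fV_surjective_of_isGalois hc (hA (n + 1)) (hA n) (f n) v₀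
      (seqBasePoint n)).choose

/-- Compatibility of the chosen base points. [cite: MochizukiSemiAnbd2006, Prop 3.6 p.38] -/
theorem seqBasePoint_succ (n : ℕ) :
    ((𝒢.ofBObj.map (f n)).fV v₀).hom.hom (𝒢.seqBasePoint hc v₀ A hA f (n + 1)) =
      𝒢.seqBasePoint hc v₀ A hA f n :=
  (𝒢.ofBObj_map_fV_surjective_of_isGalois hc (hA (n + 1)) (hA n) (f n) v₀
    (𝒢.seqBasePoint hc v₀ A hA f n)).choose_spec

/-- **Galois level data from a prescribed tower of Galois objects of `B(𝒢)`** (`𝒢` connected): levels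
`ofBObj (A n)`, transitions `ofBObj (f n)`, point-transitivity from the Galois property, compatible base
points over `v₀`. [cite: MochizukiSemiAnbd2006, Prop 3.6 p.38] -/
noncomputable def GaloisLevelData.ofGaloisSeq : GaloisLevelData 𝒢 where
  S := fun n => 𝒢.ofBObj.obj (A n)
  g := fun n => 𝒢.ofBObj.map (f n)
  htrans := fun n v x x' => 𝒢.htrans_of_isGalois hc _ (hA n) v x x'
  v₀ := v₀
  x := 𝒢.seqBasePoint hc v₀ A hA f
  hx := 𝒢.seqBasePoint_succ hc v₀ A hA f

/-- The levels of `ofGaloisSeq` (definitional). [cite: MochizukiSemiAnbd2006, Prop 3.6 p.38] -/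
theorem GaloisLevelData.ofGaloisSeq_S (n : ℕ) :
    (GaloisLevelData.ofGaloisSeq 𝒢 hc v₀ A hA f).S n = 𝒢.ofBObj.obj (A n) := rfl

/-- The transition maps of `ofGaloisSeq` (definitional). [cite: MochizukiSemiAnbd2006, Prop 3.6 p.38] -/
theorem GaloisLevelData.ofGaloisSeq_g (n : ℕ) :
    (GaloisLevelData.ofGaloisSeq 𝒢 hc v₀ A hA f).g n = 𝒢.ofBObj.map (f n) := rfl

/-- The base vertex of `ofGaloisSeq` (definitional). [cite: MochizukiSemiAnbd2006, Prop 3.6 p.38] -/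
theorem GaloisLevelData.ofGaloisSeq_v₀ : (GaloisLevelData.ofGaloisSeq 𝒢 hc v₀ A hA f).v₀ = v₀ := rfl

/-- The prescribed levels split themselves (point-transitivity). [cite: MochizukiSemiAnbd2006, Prop 3.6 p.38] -/
theorem GaloisLevelData.ofGaloisSeq_splits_self (n : ℕ) :
    ((GaloisLevelData.ofGaloisSeq 𝒢 hc v₀ A hA f).S n).Splits
      ((GaloisLevelData.ofGaloisSeq 𝒢 hc v₀ A hA f).S n) :=
  CovObj.splits_self_of_htrans _ hc v₀ ((GaloisLevelData.ofGaloisSeq 𝒢 hc v₀ A hA f).htrans n)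

/-- The prescribed levels are finite coverings. [cite: MochizukiSemiAnbd2006, Prop 3.6 p.38] -/
theorem GaloisLevelData.ofGaloisSeq_isFinite (n : ℕ) :
    ((GaloisLevelData.ofGaloisSeq 𝒢 hc v₀ A hA f).S n).IsFinite :=
  𝒢.ofBObj_isFinite (A n)

include hA in
/-- The prescribed levels have nonempty fibres (over vertices: connectedness of Galois objects; over
edges: through a gluing, `𝒢` being connected). [cite: MochizukiSemiAnbd2006, Prop 3.6 p.38] -/
theorem GaloisLevelData.ofGaloisSeq_hasNonemptyFibres (n : ℕ) :
    ((GaloisLevelData.ofGaloisSeq 𝒢 hc v₀ A hA f).S n).HasNonemptyFibres := by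
  have hV : ∀ v, Nonempty (((GaloisLevelData.ofGaloisSeq 𝒢 hc v₀ A hA f).S n).SV v).obj.V :=
    fun v => 𝒢.nonempty_fiberAt_seq hc A hA v n
  refine ⟨hV, fun e => ?_⟩
  obtain ⟨b, hbe, hb⟩ := SemiGraph.exists_abuts_of_isConnected hc v₀ e
  obtain ⟨v, hv⟩ := Option.isSome_iff_exists.mp hb
  subst hbe
  obtain ⟨x⟩ := hV v
  exact ⟨((((GaloisLevelData.ofGaloisSeq 𝒢 hc v₀ A hA f).S n).glue b v hv).inv.hom.hom x)⟩

/-- **Proposition 3.6 (i) for the prescribed tower**: `lim_n Gal(𝒢_{∞,A n}/𝒢)` is tempered.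
[cite: MochizukiSemiAnbd2006, Prop 3.6(i) p.38] -/
theorem GaloisLevelData.isTempered_temperedPi_ofGaloisSeq (h𝒢 : 𝒢.IsCountable) :
    IsTempered ((GaloisLevelData.ofGaloisSeq 𝒢 hc v₀ A hA f).temperedPi h𝒢) :=
  (GaloisLevelData.ofGaloisSeq 𝒢 hc v₀ A hA f).isTempered_temperedPi h𝒢

/-- Higher prescribed levels dominate lower ones. [cite: MochizukiSemiAnbd2006, Prop 3.6 p.38] -/
theorem GaloisLevelData.ofGaloisSeq_exists_hom_le {i j : ℕ} (hij : i ≤ j) :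
    Nonempty ((GaloisLevelData.ofGaloisSeq 𝒢 hc v₀ A hA f).S j ⟶
      (GaloisLevelData.ofGaloisSeq 𝒢 hc v₀ A hA f).S i) := by
  induction j, hij using Nat.le_induction with
  | base => exact ⟨𝟙 _⟩
  | succ k hk ih =>
    obtain ⟨φ⟩ := ih
    exact ⟨(GaloisLevelData.ofGaloisSeq 𝒢 hc v₀ A hA f).g k ≫ φ⟩

/-- **Cofinality transfer, Galois-countability form**: if every member of a Galois-countability family is
dominated by some prescribed level, every component of every tempered covering is split by the
prescribed levels from some level on. [cite: MochizukiSemiAnbd2006, Prop 3.6 p.38] -/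
theorem GaloisLevelData.ofGaloisSeq_exists_level_splits_component (hgc : 𝒢.IsGaloisCountable)
    (hdom : ∀ i, ∃ n, Nonempty ((GaloisLevelData.ofGaloisSeq 𝒢 hc v₀ A hA f).S n ⟶ hgc.2.choose i))
    (T : CovObj 𝒢) (hT : T.IsTempered) (p : T.Point) :
    ∃ n : ℕ, ∀ m, n ≤ m → ((GaloisLevelData.ofGaloisSeq 𝒢 hc v₀ A hA f).S m).Splits (T.component p) := by
  obtain ⟨F, hfin, hne, hsplit⟩ := T.exists_splits_component p hT
  obtain ⟨i, hi⟩ := hgc.2.choose_spec.2 F hfin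
  obtain ⟨n, ⟨g⟩⟩ := hdom i
  refine ⟨n, fun m hnm => ?_⟩
  obtain ⟨φ⟩ := GaloisLevelData.ofGaloisSeq_exists_hom_le 𝒢 hc v₀ A hA f hnm
  exact CovObj.Splits.trans (CovObj.Splits.of_hom (φ ≫ g) hi) hne hsplit

/-- **Cofinality transfer, relative form**: if every level of abc-iut-L3-t9's tower
`𝒢.galoisLevelData h36` is dominated by some prescribed level, every component of every tempered
covering is split by the prescribed levels from some level on. [cite: MochizukiSemiAnbd2006, Prop 3.6 p.38] -/
theorem GaloisLevelData.ofGaloisSeq_exists_level_splits_component_of_dominates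
    (h36 : 𝒢.Prop36Hypotheses)
    (hA' : ∀ n, letI := SemiGraphOfAnabelioids.galoisCategory_bObj 𝒢.toAnab ⟨h36.isConnected⟩; IsGalois (A n))
    (hdom : ∀ i, ∃ n, Nonempty ((GaloisLevelData.ofGaloisSeq 𝒢 h36.isConnected v₀ A hA' f).S n ⟶
      (𝒢.galoisLevelData h36).S i))
    (T : CovObj 𝒢) (hT : T.IsTempered) (p : T.Point) :
    ∃ n : ℕ, ∀ m, n ≤ m →
      ((GaloisLevelData.ofGaloisSeq 𝒢 h36.isConnected v₀ A hA' f).S m).Splits (T.component p) := by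
  obtain ⟨i, hi⟩ := 𝒢.exists_level_splits_component h36 T hT p
  obtain ⟨n, ⟨g⟩⟩ := hdom i
  refine ⟨n, fun m hnm => ?_⟩
  obtain ⟨φ⟩ := GaloisLevelData.ofGaloisSeq_exists_hom_le 𝒢 h36.isConnected v₀ A hA' f hnm
  exact CovObj.Splits.of_hom (φ ≫ g) (hi i le_rfl)

end ProfiniteSemiGraph

end Literature.AnabelianGeometry.SemiGraphs
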